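import Summits.Ventures.PackingBounds.Energy.TenPointPetQ2Defs
import HarnessLib

/-!
# `TenPointPetQ2`: the value of the bound `10(9c - F(1,1,1) - A(1)) = 102942875/839808`

Framing: lottery ticket; floor = certified bounds/negative ranges. Venture `PackingBounds`, cell
`pub-packcert`, energy family E3PT (pub-packcert-energy gen 14; n = 4 kernel route = KERNEL-D6 data route + `threePointF 4`).
-/

noncomputable section

namespace Summit.Ventures.PackingBounds.Energy.TenPointPetQ2

set_option maxRecDepth 20000 in
set_option maxHeartbeats 400000000 in
/-- The value of the bound: `10(9c - F(1,1,1) - A(1)) = 102942875/839808` (the `(1 + t) ^ 7 * (t + 2 / 3) ^ 2`-energy of the configuration 'Petersen code (4,10,1/6)' over ordered pairs). -/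
theorem bound_eqPQ2 : (10 : ℝ) * ((10 - 1) * c0KPQ2 - FexpKPQ2 1 1 1 - aPolyKPQ2 1) = ((102942875 : ℝ)/839808) := by
  unfold c0KPQ2 FexpKPQ2 aPolyKPQ2; ring

end Summit.Ventures.PackingBounds.Energy.TenPointPetQ2
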